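import Summits.KontsevichZagierPeriods.KontsevichZagierPeriods.Theses.LinRedNormalForm

/-!
# KontsevichZagierPeriods / LinRedNormalForm — the glue `SectorGlue` (stmt-KontsevichZagierPeriods-3916)

Route `KontsevichZagierPeriods/LinRedNormalForm` (linear reducibility read as a normal form inside the
Kontsevich–Zagier calculus of moves), support item stmt-KontsevichZagierPeriods-3916 (`SectorGlue`):

  `DihedralNormalForm → MzvKernelInKZ → GenusZeroSector`.

Informal content.  Let `r`, `r'` be two genus-zero representations (open ordered simplex, integrand a
regular top form `P(t)/(∏ tᵢ^{bᵢ} ∏ (1−tᵢ)^{cᵢ} ∏_{i<j} (tᵢ−tⱼ)^{aᵢⱼ})`) with `r.value = r'.value`.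
The normal form `DihedralNormalForm` gives `m`, `m'` in the additive closure of the MZV word
representations with `[r] − m ∈ KZ.relations` and `[r'] − m' ∈ KZ.relations`.  Soundness of the
calculus (`Literature.NumberTheory.Transcendental.KZ.relations_le_ker_eval_holds`: relations evaluate
to `0`) gives `eval m = r.value` and `eval m' = r'.value`, so `eval (m − m') = 0`; the kernel
hypothesis `MzvKernelInKZ` (applied to `m − m'`, which lies in the same closure) puts `m − m'` in
`KZ.relations`, and `[r] − [r'] = ([r] − m) − ([r'] − m') + (m − m') ∈ KZ.relations`, i.e.
`KZ.Equivalent r r'`.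

The two antecedents are the route's cruxes (items 3912, 3914) and are NOT discharged here: the
theorem is the implication, nothing more.

References: M. Kontsevich, D. Zagier, *Periods* (2001), §1.2 (the three rules; soundness);
F. Brown, *Multiple zeta values and periods of moduli spaces `𝔐_{0,n}`*, Ann. Sci. ÉNS 42 (2009),
Thm 1.1 (value-level shadow of the normal form).
-/

namespace Summit.KontsevichZagierPeriods.LinRedNormalForm

open Literature.NumberTheory.Transcendental

/-- **Sector glue of route LinRedNormalForm** (settles stmt-KontsevichZagierPeriods-3916):
`DihedralNormalForm → MzvKernelInKZ → GenusZeroSector`.  Given the genus-zero normal form (every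
genus-zero representation is congruent modulo `KZ.relations` to a `ℤ`-combination of MZV word
representations) and the kernel on normal forms (every such combination of value `0` is a relation),
two genus-zero representations `r`, `r'` of equal value are KZ-equivalent: with `[r] − m`,
`[r'] − m' ∈ relations`, soundness `KZ.relations_le_ker_eval_holds` gives `eval (m − m') =
r.value − r'.value = 0`, so `m − m' ∈ relations`, and `[r] − [r'] = ([r] − m) − ([r'] − m') + (m − m')`.
[Kontsevich–Zagier 2001, §1.2] [folklore] -/
theorem sectorGlue_proof :
    Summit.KontsevichZagierPeriods.KontsevichZagierPeriods.Theses.LinRedNormalForm.SectorGlue := by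
  unfold Summit.KontsevichZagierPeriods.KontsevichZagierPeriods.Theses.LinRedNormalForm.SectorGlue
  intro hNF hKER k k' r r' p a b c p' a' b' c' hdom hint hdom' hint' hv
  -- normal forms of the two representations
  obtain ⟨m, hm, hrm⟩ := hNF k r p a b c hdom hint
  obtain ⟨m', hm', hrm'⟩ := hNF k' r' p' a' b' c' hdom' hint'
  -- soundness of the calculus: relations evaluate to zero
  have hsound : ∀ x ∈ KZ.relations, KZ.eval x = 0 := fun x hx =>
    (AddMonoidHom.mem_ker).1 (KZ.relations_le_ker_eval_holds hx)
  have h₁ := hsound _ hrm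
  have h₂ := hsound _ hrm'
  rw [map_sub, KZ.eval_of] at h₁ h₂
  -- the difference of the normal forms has value zero, hence is a relation by the kernel hypothesis
  have hmm : KZ.eval (m - m') = 0 := by
    rw [map_sub]
    linarith
  have hker : m - m' ∈ KZ.relations := hKER (m - m') (sub_mem hm hm') hmm
  -- add up
  show KZ.of r - KZ.of r' ∈ KZ.relations
  have key := add_mem (sub_mem hrm hrm') hker
  rwa [show KZ.of r - m - (KZ.of r' - m') + (m - m') = KZ.of r - KZ.of r' by abel] at key

end Summit.KontsevichZagierPeriods.LinRedNormalForm
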